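import Summits.AtomisticToContinuum.BoseEinsteinCondensation.Theses.BECInsertionCorrector
import Summits.AtomisticToContinuum.BoseEinsteinCondensation.Theses.BECSectorPoincareTwoScale
import Summits.AtomisticToContinuum.BoseEinsteinCondensation.Theorems.BECInsertionCorrectorCorrectorClosureReductionToFactors
import Summits.AtomisticToContinuum.BoseEinsteinCondensation.Theorems.BECInsertionCorrectorStaticResponseToHMinusOne
import Summits.AtomisticToContinuum.BoseEinsteinCondensation.Theorems.BECFeynmanVortexAreaVortexAreaToPeriodicBEC
import Literature.MathematicalPhysics.QuantumManyBody.WeightedCorrector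
import Literature.MathematicalPhysics.QuantumManyBody.PeriodicHeatFlowSpectral
import Literature.MathematicalPhysics.QuantumManyBody.PeriodicBoseGasTagged
import Literature.MathematicalPhysics.QuantumManyBody.PeriodicBoseGasFracEnergy
import Literature.MathematicalPhysics.QuantumManyBody.TorusFockLayer
import Summits.AtomisticToContinuum.BoseEinsteinCondensation.Theorems.BECInsertionCorrectorCorrectorClosureHoleKLS
import Summits.AtomisticToContinuum.BoseEinsteinCondensation.Theorems.BECInsertionCorrectorCorrectorClosureFirstOrderInput
import Summits.AtomisticToContinuum.BoseEinsteinCondensation.Theorems.BECInsertionCorrectorCorrectorClosureModeCount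
import Summits.AtomisticToContinuum.BoseEinsteinCondensation.Theorems.BECInsertionCorrectorCorrectorClosureHoleModeReduction
import Summits.AtomisticToContinuum.BoseEinsteinCondensation.Theorems.BECInsertionCorrectorCorrectorClosureHoleModeDominationOfGD
import Summits.AtomisticToContinuum.BoseEinsteinCondensation.Theorems.BECInsertionCorrectorCorrectorClosurePeriodicBECOfHoleMode
import HarnessLib.Audit

/-!
# Line `insertion-mode-gaussian-domination` — skeleton v2.2 (lead c6 v2/v2.1; lead c7 v2.2 header, 2026-08-17) for crux
`BECInsertionCorrector.CorrectorClosure` (item stmt-AtomisticToContinuum-12058, route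
route-AtomisticToContinuum-BECInsertionCorrector; v1 by crux-plan seat
planner-cruxplan-stmt-AtomisticToContinuum-12058-insertion-mode-gauss-0, card
`Cruxes/CorrectorClosure/Ideas/insertion-mode-gaussian-domination.md`, triage r2-1/2/3: pass ×3)

Crux (fixed, by name): `CorrectorClosure := StaticResponseBound → InsertionResidue` ("K1 → target").

## v2 reshape (lead c6): the provable stubs are re-typed onto the LANDED torus Fock layer

v1's vocabulary (`holeCos/holeSin/modeOccupation/holeSusceptibility`, line-local `def`s) is replaced by the
tree's one: the hole state is `a(φ_n)Φ = modeAn L (planeWaveMode L n) Φ` (`Literature/…/TorusFockLayer`,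
`φ_n = L^{-3/2} e^{ip·x}`, `p = 2πn/L = latticeVec (2π/L) n`), its occupation is
`n_n = cellOccupation (N+1) L (planeWaveMode L n) Φ` (`= ‖a(φ_n)Φ‖²`, `WF.normSq_modeAn`), and the removal
susceptibility is `b₋(n) = ‖Re a(φ_n)Φ / Θ₀‖²₋₁ + ‖Im a(φ_n)Φ / Θ₀‖²₋₁` (`hMinusOneSqW`, weight `Θ₀`; the
factor `ρ = (N+1)/L³` of v1 is inside `modeAn`'s `√(N+1)` and `planeWaveMode`'s `L^{-3/2}`). With this:

* S1 `stub_holeKLS` (hole-channel Kennedy–Lieb–Shastry + CCR budget) becomes GLUE over the landed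
  Wagner–Feynman toolkit of crux PeriodicIRBound (`WF.wagnerFeynman_form_le` = the double-commutator budget
  `𝓔[aΦ] + 𝓔[a†Φ] ≤ (p² + 2(N+1)‖v‖₁/L³)‖Φ‖² + 𝓔[Φ] + 2 Re B(Φ, a†aΦ)` in first quantisation,
  `WF.normSq_modeCr` = `‖a†Φ‖² = 1 + n_n`, `WF.abs_formRe_sub_le` at `δ = 0` + `WF.innerRe_numOp` =
  `Re B(Φ₀, a†aΦ₀) = E₀(N+1)·n_n` for the exact minimiser, `WF.groundStateEnergy_mul_normSq_le` = the
  `(N+2)`-body variational principle at `a†Φ₀`), the ground-state representation w.r.t. `Θ₀` (`tilt_el_all`)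
  and the single-mode `H₋₁` Cauchy–Schwarz (`ofReal_sq_div_dirichletFormW_le_hMinusOneSqW`); it is stated
  against a REAL susceptibility bound `b` (`b₋(n) ≤ ofReal b → n_n² ≤ b·budget`), which is how S4 consumes it
  and which makes the `ENNReal` degenerate cases (`⊤ * 0`) disappear;
* S2 is re-typed as `stub_firstOrderInput`: K1 — consumed HERE by name — in its landed `H₋₁` currency (item
  12060, `staticResponseToHMinusOne_proof`) for BOTH quadratures `C_n = Σcos`, `S_n = Σsin` of the bath density
  mode, at the bath density `ρ' = N/L³` in the `(N+1)`-box (`sideLength ρ' N = sideLength ρ (N+1)`, Disproof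
  §14(ii)); the sine quadrature by translation covariance of `‖·‖₋₁` and `fkGroundState_translate_eq`. v1's S2
  asked in addition for `C¹` massive correctors `χ = (−G_N + p²)⁻¹(v̂ C_n)` — divergence-form Schauder theory on
  `Config N`, not in the tree and not needed by the composition: the recoil resolvent now lives inside the heart;
* S3 `stub_remainderDomination` (THE HEART, held by the lead, XL) takes S2's output as hypothesis and concludes
  hole-mode Gaussian domination `b₋(n) ≤ Bρ/p⁴` on the window `p² ≤ M₀²ρa` (transfer target C⁺ =
  `HoleModeDomination` of the card: first order `‖R_n(v̂C_n)‖²₋₁ ≤ p⁻⁴‖v̂C_n‖²₋₁` + remainder (R));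
* S4 `stub_modeCount` (the `d = 3` count) is typed against S1's real form and the tree's Parseval
  (`tsum_cellOccupation_planeWaveMode_eq`, `lintegral_kineticDensity_eq_tsum_normSq_modeAn`,
  `cellOccupation_planeWaveMode_zero`, `succ_mul_taggedZeroModeOccupation`);
* S5 (`stub_nearConvexity` = item 9094 at `ε = 1`), S6 (`stub_removalFidelity`, shared factor 2), S7
  (`stub_unboundedCase`, shared scope hole) are VERBATIM v1 (shared signatures of p122159 / residue_area_law v6.1).
Composition unchanged: `f0Floor_of_stubs` (S1–S5) → `residueFloor_of_f0'` → `correctorClosure_of_f0` →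
`CorrectorClosure_of : CorrectorClosure` (sorry-free glue; `sorry` only in the seven `stub_*`).

## v2.2 (lead c7, 2026-08-17): no reshape — the four open stubs are item-sized; first-order budget of the heart LANDED

Stubs unchanged and re-registered (S3 `stub_remainderDomination`, S5 `stub_nearConvexity` = item 9094, S6
`stub_removalFidelity` = the zero-mode line's heart R over the landed budget p135833, S7 `stub_unboundedCase` = hard-core
scope hole). Heart dossier: `Cruxes/CorrectorClosure/Lines/insertion-mode-gaussian-domination-heart.md` (μ-split of S3 in
h-variables; source-mode budget in ψ-variables). New importable aux lemmas of this line (all `--supports` 12058):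
`driftMode_hMinusOneSqW_le_shift` (p163940, `Theorems/…DriftMode.lean`), `driftMode_cos_/sin_hMinusOneSqW_le` (p164123,
`…DriftModeQuadratures.lean`), `driftMode_bound_of_staticResponseBound` (p164465, `…DriftModeOfK1.lean`: K1 + f-sum bound the
bath DRIFT modes of the true FK bath ground state with the `Bρ/p⁴` shape C⁺ allows), `holeMode_coercive_bound` (p164257,
`…CoerciveOccupation.lean`: above the chemical potential the hole-mode equation p150790 bounds `L²(Θ₀²)` mass and Dirichlet
energy of both hole quadratures by the interaction vertex alone). What is left of S3 is ≥ 3-body / nonlinear (pair-density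
static response, reverse Hölder, `ĥ ↔ ψ̂` conversion) = the pooled IR programme (C⁺ ⇐ 12620, p146353).

## Idea (one paragraph, v1)

Every earlier line of this crux died at an `N`-uniform FLOOR on the zero mode (`K1 → PeriodicBEC`,
kernel-checked necessary, p121285). This line takes no floor anywhere. It bounds every NONZERO plane-wave
occupation `n_k(Φ₀)` of the true `(N+1)`-body torus ground state `Φ₀` from ABOVE and lets the sum rule
`Σ_k n_k = N+1` produce the zero-mode floor: one-sector spectral Cauchy–Schwarz (Kennedy–Lieb–Shastry in the
hole channel only) gives `n_k² ≤ b₋(k)·d₋(k)` with the CCR budget `d₋(k) ≤ p² + 2ρ‖v‖₁ + μ_N n_k − μ_{N+1}(n_k+1)`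
(S1); K1 in `H₋₁` form bounds the first-order hole mode (S2); the HEART is the remainder: full domination
`b₋(k) ≤ Bρ/p⁴` on `p² ≤ M₀²ρa` (S3); the `d = 3` lattice count with near-convexity of `N ↦ E₀(N,L)` (S5 = item
9094) turns `Σ n_k = N+1` into `f₀(Φ₀) ≥ c₁` (S4); factor 2 (S6) and the hard-core hole (S7) complete
`CorrectorClosure` through the landed fixed-`N` frame (`stub_groundStateExists` p92339,
`stub_nearMinimiserRigidity` p85784) as in `correctorClosure_of_factors` (p122159).

## Disproof.lean (gen 4 v10) and landed `Negative/*` — obligations honoured (v1 audit, re-read by c6)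

§1 K1 is USED, at S2 only; S1, S3, S4 are K1-free by design. §3/§7: every stub is about EXACT FK ground
states; window/`δ` after `N` only via `stub_nearMinimiserRigidity` in the glue. §4 `E₀^per(N+1) < ⊤`:
`IsPeriodicGroundStateFK.energy_ne_top`; `Λ = 2ρ‖v‖₁ < ∞` explicit in S1 (`∫v < ∞` for bounded finite-range
`v`, `VortexAreaToPeriodicBEC.lintegral_ne_top_of_bounded`). §5 `A ≤ f₀`: the line SUPPLIES the `f₀` floor.
§13: the `d`-sensitive step is the lattice count inside S4 and nowhere else. §14(ii): S2 consumes K1 at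
`ρ' = N/L³`. §16: S1's Cauchy–Schwarz IS `ofReal_sq_div_dirichletFormW_le_hMinusOneSqW`; all `H₋₁` bounds
here are UPPER bounds. No stub is an instance of a landed Negative lemma (checked by name, v1 list).
-/

noncomputable section

open MeasureTheory Filter Matrix
open scoped ENNReal NNReal BigOperators ComplexConjugate

namespace Summit.AtomisticToContinuum.BoseEinsteinCondensation.Cruxes.CorrectorClosure.InsertionModeGaussianDomination

open Literature.MathematicalPhysics.QuantumManyBody.BoseGas
open Summit.AtomisticToContinuum.BoseEinsteinCondensation.Theses.BECInsertionCorrector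
open Summit.AtomisticToContinuum.BoseEinsteinCondensation.Theorems.CorrectorClosure.Negative
  (sideLength_succ_pos)
open Summit.AtomisticToContinuum.BoseEinsteinCondensation.Theorems.CorrectorClosure.ResidueAreaLaw
  (stub_groundStateExists taggedZeroModeOccupation_ofReal_eq)
open Summit.AtomisticToContinuum.BoseEinsteinCondensation.Theorems.CorrectorClosure.HealingScaleKacInsertion
  (stub_nearMinimiserRigidity)
open Summit.AtomisticToContinuum.BoseEinsteinCondensation.Theorems.VortexAreaToPeriodicBEC
  (lintegral_ne_top_of_bounded)

set_option linter.unusedVariables false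

variable {N : ℕ}

/-! ## Vocabulary (all from the tree; nothing is defined in this file)

* hole state `a(φ_n)Φ₀ : Config N → ℂ` := `modeAn L (planeWaveMode L n) (fun X => (Φ₀ X : ℂ))`;
* occupation `n_n := (cellOccupation (N+1) L (planeWaveMode L n) (fun X => (Φ₀ X : ℂ))).toReal` (`= ‖a(φ_n)Φ₀‖²`);
* removal susceptibility `b₋(n) := hMinusOneSqW L Θ₀ (Re a(φ_n)Φ₀ / Θ₀) + hMinusOneSqW L Θ₀ (Im a(φ_n)Φ₀ / Θ₀)`;
* `p² := ‖latticeVec (2π/L) n‖²`, `‖v‖₁ := (∫⁻ x, v ‖x‖).toReal`, `μ_N := E₀(N+1,L) − E₀(N,L)`,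
  bath modes `C_n(X) = Σ_j cos(2π/L · n·X_j)`, `S_n(X) = Σ_j sin(2π/L · n·X_j)` (the observable of item 12060).
-/

/-! ## Stubs (the open / delegated lemmas of the line; `sorry` only here) -/

/-- **S1 `stub_holeKLS` — one-sector Kennedy–Lieb–Shastry inequality in the HOLE channel with the CCR
energy budget, real form (size M over the landed WF toolkit; K1-free; fixed `N ≥ 1`, `L > 0`).** For a repulsive
finite-range integrable `v` with `v^per` bounded on the torus of side `L`, the continuous positive FK ground states
`Θ₀` (`N` bodies), `Φ₀` (`N+1` bodies), every `n ≠ 0` and every real `b ≥ 0` dominating the removal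
susceptibility `b₋(n) ≤ b`:
`n_n² ≤ b · (p² + 2(N+1)‖v‖₁/L³ + μ_N n_n − μ_{N+1}(n_n + 1))`.
Proof on paper (every analytic input landed): with `Φ = (Φ₀ : ℂ)` (an `IsCore` state, `C¹` by
`stub_periodicGroundStateRegularity`, of energy `qform v L Φ = E₀(N+1)` by `periodicEnergy_le_of_isPeriodicGroundStateFK`),
`a = modeAn L φ_n Φ`, `c = modeCr φ_n Φ`: (i) `WF.wagnerFeynman_form_le` (needs `N+1 = m+2`):
`𝓔[a] + 𝓔[c] ≤ (p² + Λ)·1 + E₀(N+1) + 2 Re B(Φ, a†aΦ)`; (ii) `WF.abs_formRe_sub_le` at `δ = 0` with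
`WF.innerRe_numOp`: `Re B(Φ, a†aΦ) = E₀(N+1)·n_n`; (iii) `WF.groundStateEnergy_mul_normSq_le` + `WF.normSq_modeCr`:
`E₀(N+2)(1 + n_n) ≤ 𝓔[c]` (finite by `WF.qform_modeCr_le`); hence `𝓔[a] − E₀(N)·n_n ≤ budget`;
(iv) ground-state representation for the weight `Θ₀` (`tilt_el_all` tested with `ζ = f²`, `f = Re a/Θ₀`, resp.
`Im a/Θ₀`, both `C¹` periodic): `𝓔[a] − E₀(N)‖a‖² = 𝓔_Θ₀(Re a/Θ₀) + 𝓔_Θ₀(Im a/Θ₀)` with `‖a‖² = n_n`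
(`WF.normSq_modeAn`, `kineticDensity_eq_realKinetic_add`); (v) single-mode Cauchy–Schwarz
`(∫ f²Θ₀²)² ≤ ‖f‖²₋₁·𝓔_Θ₀(f,f)` (`ofReal_sq_div_dirichletFormW_le_hMinusOneSqW`; if `𝓔_Θ₀(f,f) = 0` and
`∫f²Θ₀² ≠ 0` then `‖f‖₋₁ = ⊤` by `hMinusOneSqW_eq_top_of_dirichletFormW_self_eq_zero`, contradicting `b₋ ≤ b`),
and `(x+y)² ≤ (b₁+b₂)(d₁+d₂)` from `x² ≤ b₁d₁`, `y² ≤ b₂d₂`. Bogoliubov-saturated; `v = 0` ⇒ `n_n = 0` ✓.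
[cite: KLS1988JSP, (12)–(14); PitaevskiiStringari1991, §II; KipnisLandim1999, App. 1 §6 (6.1)] -/
theorem stub_holeKLS (v : ℝ → ℝ≥0∞) (hv : IsRepulsiveFiniteRange v) (hint : (∫⁻ x : Space, v ‖x‖) ≠ ⊤)
    (N : ℕ) (hN : 1 ≤ N) (L : ℝ) (hL : 0 < L) (hb : ∃ C : ℝ≥0, ∀ x, periodizedPotential v L x ≤ C)
    (Θ₀ : Config N → ℝ) (hΘ : IsPeriodicGroundStateFK v L Θ₀) (hΘc : Continuous Θ₀) (hΘp : ∀ X, 0 < Θ₀ X)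
    (Φ₀ : Config (N + 1) → ℝ) (hΦ : IsPeriodicGroundStateFK v L Φ₀) (hΦc : Continuous Φ₀)
    (hΦp : ∀ X, 0 < Φ₀ X) (n : Fin 3 → ℤ) (hn : n ≠ 0) (b : ℝ) (hb0 : 0 ≤ b)
    (hdom : hMinusOneSqW L Θ₀ (fun Y => (modeAn L (planeWaveMode L n) (fun X => (Φ₀ X : ℂ)) Y).re / Θ₀ Y) +
        hMinusOneSqW L Θ₀ (fun Y => (modeAn L (planeWaveMode L n) (fun X => (Φ₀ X : ℂ)) Y).im / Θ₀ Y) ≤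
      ENNReal.ofReal b) :
    (cellOccupation (N + 1) L (planeWaveMode L n) (fun X => (Φ₀ X : ℂ))).toReal ^ 2 ≤
      b * (‖latticeVec (2 * Real.pi / L) n‖ ^ 2 + 2 * ((N : ℝ) + 1) * (∫⁻ x : Space, v ‖x‖).toReal / L ^ 3
        + ((periodicGroundStateEnergy v (N + 1) L).toReal - (periodicGroundStateEnergy v N L).toReal) *
            (cellOccupation (N + 1) L (planeWaveMode L n) (fun X => (Φ₀ X : ℂ))).toReal
        - ((periodicGroundStateEnergy v (N + 2) L).toReal - (periodicGroundStateEnergy v (N + 1) L).toReal) *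
            ((cellOccupation (N + 1) L (planeWaveMode L n) (fun X => (Φ₀ X : ℂ))).toReal + 1)) :=
  -- LANDED (wave 1, p141192): `Theorems/BECInsertionCorrectorCorrectorClosureHoleKLS.lean`
  Summit.AtomisticToContinuum.BoseEinsteinCondensation.Theorems.CorrectorClosure.InsertionModeGaussianDomination.stub_holeKLS v hv hint N hN L hL hb Θ₀ hΘ hΘc
    hΘp Φ₀ hΦ hΦc hΦp n hn b hb0 hdom

/-- **S2 `stub_firstOrderInput` — K1 in `H₋₁` currency for both quadratures of the bath density mode, at the
bath density, for the true FK bath ground state (size M; K1 consumed HERE, by name).** Given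
`StaticResponseBound`, for every repulsive finite-range `v` there are `B₁, ρ₂ > 0` such that for `0 < ρ < ρ₂`, all
large `N`, the box `L = sideLength ρ (N+1)` (`v^per` bounded) and the continuous positive FK bath ground state `Θ₀`,
and every `n ≠ 0`: `‖C_n‖²₋₁ + ‖S_n‖²₋₁ ≤ B₁ N / max(ρ'a, p²)`, `ρ' = N/L³`, `a` the scattering length — the
first-order datum of the hole mode (by the exact mode equation `ψ̂_n = v̂(p)R_nρ̄_n − R_nΓ̂_n` the first-order hole
mode is `R_n(v̂(p)(C_n − iS_n))`, `R_n = (−G_N + p²)⁻¹`; the resolvent contraction is part of S3).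
Proof on paper: K1 at `(ρ', N)` with `ρ' = ρN/(N+1) ∈ (0, ρ₀)` lives in the SAME box (`sideLength ρ' N = L`,
Disproof §14(ii), `ρ'·a = (N/L³)·a` by `div_sideLength_pow_three`); `Θ₀` read as a real nonnegative
`PeriodicTrialState` attaining `E₀(N, L) < ⊤` (`stub_periodicGroundStateRegularity`, `exists_trialState_of_fk`,
`periodicEnergy_le_of_isPeriodicGroundStateFK`); the landed dictionary `staticResponseToHMinusOne_proof` (item 12060)
gives `‖C_n‖²₋₁ ≤ C N/max(ρ'a, p²)`; the sine mode is the cosine mode translated by `u` with `p·u = −π/2`, and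
`‖g ∘ τ_u‖₋₁ = ‖g‖₋₁` for the weight `Θ₀` (`fkGroundState_translate_eq`, `setIntegral_cellN_comp_add` /
`lintegral_cellN_comp_add`, periodic tests are translation-stable); `B₁ = 2C`. `N = 0` is excluded eventually.
[cite: KipnisVaradhan1986, (1.14); KipnisLandim1999, App. 1 §6 Prop. 6.1] -/
theorem stub_firstOrderInput (hK1 : StaticResponseBound) (v : ℝ → ℝ≥0∞) (hv : IsRepulsiveFiniteRange v) :
    ∃ B₁ : ℝ, 0 < B₁ ∧ ∃ ρ₂ : ℝ, 0 < ρ₂ ∧ ∀ ρ : ℝ, 0 < ρ → ρ < ρ₂ → ∀ᶠ N : ℕ in atTop,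
      ∀ (L : ℝ), L = sideLength ρ (N + 1) → (∃ C : ℝ≥0, ∀ x, periodizedPotential v L x ≤ C) →
      ∀ (Θ₀ : Config N → ℝ), IsPeriodicGroundStateFK v L Θ₀ → Continuous Θ₀ → (∀ X, 0 < Θ₀ X) →
      ∀ (n : Fin 3 → ℤ), n ≠ 0 →
        hMinusOneSqW L Θ₀ (fun X => ∑ j, Real.cos (2 * Real.pi / L * ∑ i, (n i : ℝ) * X j i)) +
          hMinusOneSqW L Θ₀ (fun X => ∑ j, Real.sin (2 * Real.pi / L * ∑ i, (n i : ℝ) * X j i)) ≤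
        ENNReal.ofReal (B₁ * N / max ((N : ℝ) / L ^ 3 * (scatteringLength v).toReal)
          ((2 * Real.pi / L) ^ 2 * ∑ i, (n i : ℝ) ^ 2)) :=
  -- LANDED (wave 1, p141534): `Theorems/BECInsertionCorrectorCorrectorClosureFirstOrderInput.lean`
  Summit.AtomisticToContinuum.BoseEinsteinCondensation.Theorems.CorrectorClosure.InsertionModeGaussianDomination.stub_firstOrderInput hK1 v hv

/-- **S3 `stub_remainderDomination` — THE HEART: remainder domination (R), i.e. the first-order `H₋₁` input of
S2 implies FULL Gaussian domination of the hole mode `b₋(n) ≤ Bρ/p⁴` on the window `p² ≤ M₀²ρa` (size XL; K1-free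
as typed; the transfer target C⁺ = `HoleModeDomination` of the card).** For every bounded repulsive finite-range
`v`, every first-order constant `B₁ > 0` and window parameter `M₀ > 0` there are `B, ρ₃ > 0` such that for
`0 < ρ < ρ₃`, all large `N`, the box `L = sideLength ρ (N+1)`, the continuous positive FK ground states `Θ₀, Φ₀`,
every `n ≠ 0` with `p² ≤ M₀²ρa` at which the bath modes obey S2's bound:
`‖Re a(φ_n)Φ₀/Θ₀‖²₋₁ + ‖Im a(φ_n)Φ₀/Θ₀‖²₋₁ ≤ Bρ/p⁴`.
Content (card (R) + triage r2-2/r2-3): by the exact mode equation the hole mode `ĥ_n = a(φ_n)Φ₀/(√ρ Θ₀)·(phase)`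
splits into (o) the first-order massive corrector `κ R_n(v̂(p)(C_n − iS_n))`, `κ² ≍ L⁻³`, whose `H₋₁` norm is
`≤ p⁻⁴ v̂(p)²(‖C_n‖²₋₁ + ‖S_n‖²₋₁) ≤ ‖v‖₁² B₁ N/(p⁴ max(ρ'a,p²))` (resolvent contraction
`∫dμ_g/(ω(ω+p²)²) ≤ p⁻⁴‖g‖²₋₁`, i.e. `ρ·(that) ≤ (2B₁‖v‖₁²/a)·ρ/p⁴` on the window), (a) the two-mode term
`κR_nΓ̂_n`, `Γ = |∇ψ|²`, needing only the EXTENSIVE bound `‖Γ̂_n‖²₋₁ ≤ B′L³/ξ²` behind the recoil factor `p⁻⁴`,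
and (b) the conversion `FT_y(e^{−ψ}) ↔ −κψ̂_n` (reverse-Hölder `E h⁴ ≤ C(Eh²)²`); then `‖Σ‖²₋₁ ≤ 3Σ‖·‖²₋₁`.
Only BOUNDEDNESS with `p⁻⁴` slack and `(ρa³)^{-1/2}` tolerance is asked. Why it might fail: an `H₋₁` norm of the
two-phonon part of `ĥ_n` growing with `L` at `p = 2π/L` (checked absent at one loop by all three triagers). Why it
is NOT the crux in costume: TRUE in `d = 1`, strictly weaker than sibling 12620 `GaussianDomination` (`b± ≤ C/k²`)
and than 9091 `LandauSectorBound`; `d = 3` is spent only in S4. `a.toReal = 0` ⇒ empty window ✓; `v = 0` ⇒ `b₋ = 0` ✓.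
[cite: KipnisVaradhan1986, Thm 1.8; KomorowskiLandimOlla2012, Ch. 2 §2.7; GavoretNozieres1964, §4;
ReattoChester1967, (8)–(12)] -/
theorem stub_remainderDomination (v : ℝ → ℝ≥0∞) (hv : IsRepulsiveFiniteRange v)
    (hbdd : ∃ C : ℝ≥0, ∀ r, v r ≤ C) (B₁ : ℝ) (hB₁ : 0 < B₁) (M₀ : ℝ) (hM₀ : 0 < M₀) :
    ∃ B : ℝ, 0 < B ∧ ∃ ρ₃ : ℝ, 0 < ρ₃ ∧ ∀ ρ : ℝ, 0 < ρ → ρ < ρ₃ → ∀ᶠ N : ℕ in atTop,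
      ∀ (L : ℝ), L = sideLength ρ (N + 1) → (∃ C : ℝ≥0, ∀ x, periodizedPotential v L x ≤ C) →
      ∀ (Θ₀ : Config N → ℝ), IsPeriodicGroundStateFK v L Θ₀ → Continuous Θ₀ → (∀ X, 0 < Θ₀ X) →
      ∀ (Φ₀ : Config (N + 1) → ℝ), IsPeriodicGroundStateFK v L Φ₀ → Continuous Φ₀ →
        (∀ X, 0 < Φ₀ X) →
      ∀ (n : Fin 3 → ℤ), n ≠ 0 →
        ‖latticeVec (2 * Real.pi / L) n‖ ^ 2 ≤ M₀ ^ 2 * ρ * (scatteringLength v).toReal →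
        hMinusOneSqW L Θ₀ (fun X => ∑ j, Real.cos (2 * Real.pi / L * ∑ i, (n i : ℝ) * X j i)) +
            hMinusOneSqW L Θ₀ (fun X => ∑ j, Real.sin (2 * Real.pi / L * ∑ i, (n i : ℝ) * X j i)) ≤
          ENNReal.ofReal (B₁ * N / max ((N : ℝ) / L ^ 3 * (scatteringLength v).toReal)
            ((2 * Real.pi / L) ^ 2 * ∑ i, (n i : ℝ) ^ 2)) →
        hMinusOneSqW L Θ₀ (fun Y => (modeAn L (planeWaveMode L n) (fun X => (Φ₀ X : ℂ)) Y).re / Θ₀ Y) +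
            hMinusOneSqW L Θ₀ (fun Y => (modeAn L (planeWaveMode L n) (fun X => (Φ₀ X : ℂ)) Y).im / Θ₀ Y) ≤
          ENNReal.ofReal (B * ρ / (‖latticeVec (2 * Real.pi / L) n‖ ^ 2) ^ 2) := by
  sorry

/-- **S4 `stub_modeCount` — the `d = 3` mode count: hole-channel KLS (real form) + Gaussian domination on the
window + near-convexity + the sum rule `Σ_n n_n = N+1` give torus BEC of the TRUE ground state, `f₀(Φ₀) ≥ c₁`
(size L; K1-free; the ONLY dimension-sensitive step of the line, Disproof §13).** For every bounded repulsive
finite-range `v` whose torus energy is nearly convex in `N` (the hypothesis = S5's conclusion, item 9094 at `ε = 1`)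
there is a window parameter `M₀ > 0` such that for every domination constant `B > 0` there are `ρ₄, c₁ > 0` with:
for `0 < ρ < ρ₄`, all large `N`, `L = sideLength ρ (N+1)`, the continuous positive FK ground states `Θ₀, Φ₀`, IF
every `n ≠ 0` satisfies S1's real inequality (for every real `b ≥ b₋(n)`) and every `n ≠ 0` in the window
`p² ≤ M₀²ρa` satisfies `b₋(n) ≤ Bρ/p⁴`, THEN `taggedZeroModeOccupation N L Φ₀ ≥ c₁` (`= n_0/(N+1)`).
Proof on paper: (i) Parseval in the removed coordinate: `Σ_{n∈ℤ³} n_n = (N+1)·‖Φ‖² = N+1`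
(`tsum_cellOccupation_planeWaveMode_eq`), `n_0 = condensateOccupation = (N+1)f₀` (`cellOccupation_planeWaveMode_zero`,
`succ_mul_taggedZeroModeOccupation`); kinetic Parseval `Σ_n p² n_n = T(Φ₀)`
(`lintegral_kineticDensity_eq_tsum_normSq_modeAn`) `≤ E₀(N+1,L) ≤ 4πρ₁a(1+Ca/b)(N+1)`
(`LSSY2005_upperBound_periodic_holds`; `Φ₀` is `C¹` and attains `E₀`); (ii) on the window, from S1 at
`b = Bρ/p⁴` and `μ_{N+1} ≥ 0` (`periodicGroundStateEnergy_le_succ`): `n_n² ≤ b(p² + Λ) + bη n_n`,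
`η = (μ_N − μ_{N+1})₊ ≤ √(ρa)/L` by near-convexity, so `n_n ≤ bη + √(b(p²+Λ))` (`kls_quadratic`);
(iii) window sums: `Σ √(Bρ(p²+Λ))/p² ≤ √(Bρ(M₀²ρa+Λ))(L/2π)²·26 n_c`, `n_c = M₀√(ρa)L/2π` — THE `d = 3` COUNT
`Σ_{0<|n|≤R}|n|⁻² ≤ 26R` (`sum_inv_norm_sq_latticeShell_le`) — `= (N+1)·O(√(ρa³))`, and the slack
`Σ ηBρ(L/2π)⁴|n|⁻⁴ ≤ (N+1)·B√(ρa)Z₄/(2π)⁴`, `Z₄ = Σ_{n≠0}|n|⁻⁴ ≤ 43` — where near-convexity is load-bearing;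
(iv) UV tail by kinetic Chebyshev: `Σ_{p²>M₀²ρa} n_n ≤ T/(M₀²ρa) ≤ (N+1)/8` for `M₀² = 64π`; (v)
`f₀ ≥ 1 − 1/8 − o(1) ≥ 1/2 =: c₁` for `ρ < ρ₄(B, v)`. Degenerate cases: `a.toReal = 0` ⇒ `E₀ = 0` ⇒ `T = 0` ⇒
`n_n = 0` for `n ≠ 0` ⇒ `f₀ = 1` ✓; `v = 0` ⇒ `f₀ = 1` ✓. In `d = 1` the window sum is `∝ L² ≫ ρL`: no conclusion.
Templates: `LaplacianModeCounting.condensate_ge_half_sq`, `TwoSectorGdTransfer.WindowArith.nk_le`,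
`momentBoundCondensation_proof`. [cite: KLS1988PRL, (5)–(9); LSSY2005, Thm 2.2 (2.14); Fournais2020, (1.3)–(1.5)] -/
theorem stub_modeCount (v : ℝ → ℝ≥0∞) (hv : IsRepulsiveFiniteRange v) (hbdd : ∃ C : ℝ≥0, ∀ r, v r ≤ C)
    (hconv : ∃ ρ₅ : ℝ, 0 < ρ₅ ∧ ∀ ρ : ℝ, 0 < ρ → ρ < ρ₅ → ∀ᶠ N : ℕ in atTop,
      2 * periodicGroundStateEnergy v (N + 1) (sideLength ρ (N + 1)) ≤
        periodicGroundStateEnergy v (N + 2) (sideLength ρ (N + 1)) +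
          periodicGroundStateEnergy v N (sideLength ρ (N + 1)) +
          ENNReal.ofReal (Real.sqrt (ρ * (scatteringLength v).toReal) / sideLength ρ (N + 1))) :
    ∃ M₀ : ℝ, 0 < M₀ ∧ ∀ B : ℝ, 0 < B → ∃ ρ₄ : ℝ, 0 < ρ₄ ∧ ∃ c₁ : ℝ, 0 < c₁ ∧
      ∀ ρ : ℝ, 0 < ρ → ρ < ρ₄ → ∀ᶠ N : ℕ in atTop,
      ∀ (L : ℝ), L = sideLength ρ (N + 1) → (∃ C : ℝ≥0, ∀ x, periodizedPotential v L x ≤ C) →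
      ∀ (Θ₀ : Config N → ℝ), IsPeriodicGroundStateFK v L Θ₀ → Continuous Θ₀ → (∀ X, 0 < Θ₀ X) →
      ∀ (Φ₀ : Config (N + 1) → ℝ), IsPeriodicGroundStateFK v L Φ₀ → Continuous Φ₀ →
        (∀ X, 0 < Φ₀ X) →
      (∀ n : Fin 3 → ℤ, n ≠ 0 → ∀ b : ℝ, 0 ≤ b →
        hMinusOneSqW L Θ₀ (fun Y => (modeAn L (planeWaveMode L n) (fun X => (Φ₀ X : ℂ)) Y).re / Θ₀ Y) +
            hMinusOneSqW L Θ₀ (fun Y => (modeAn L (planeWaveMode L n) (fun X => (Φ₀ X : ℂ)) Y).im / Θ₀ Y) ≤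
          ENNReal.ofReal b →
        (cellOccupation (N + 1) L (planeWaveMode L n) (fun X => (Φ₀ X : ℂ))).toReal ^ 2 ≤
          b * (‖latticeVec (2 * Real.pi / L) n‖ ^ 2 + 2 * ((N : ℝ) + 1) * (∫⁻ x : Space, v ‖x‖).toReal / L ^ 3
            + ((periodicGroundStateEnergy v (N + 1) L).toReal - (periodicGroundStateEnergy v N L).toReal) *
                (cellOccupation (N + 1) L (planeWaveMode L n) (fun X => (Φ₀ X : ℂ))).toReal
            - ((periodicGroundStateEnergy v (N + 2) L).toReal
                - (periodicGroundStateEnergy v (N + 1) L).toReal) *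
                ((cellOccupation (N + 1) L (planeWaveMode L n) (fun X => (Φ₀ X : ℂ))).toReal + 1))) →
      (∀ n : Fin 3 → ℤ, n ≠ 0 →
        ‖latticeVec (2 * Real.pi / L) n‖ ^ 2 ≤ M₀ ^ 2 * ρ * (scatteringLength v).toReal →
        hMinusOneSqW L Θ₀ (fun Y => (modeAn L (planeWaveMode L n) (fun X => (Φ₀ X : ℂ)) Y).re / Θ₀ Y) +
            hMinusOneSqW L Θ₀ (fun Y => (modeAn L (planeWaveMode L n) (fun X => (Φ₀ X : ℂ)) Y).im / Θ₀ Y) ≤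
          ENNReal.ofReal (B * ρ / (‖latticeVec (2 * Real.pi / L) n‖ ^ 2) ^ 2)) →
      ENNReal.ofReal c₁ ≤ taggedZeroModeOccupation N L (fun X => (Φ₀ X : ℂ)) :=
  -- LANDED (wave 1, p143883 over p142666/p142747): `Theorems/BECInsertionCorrectorCorrectorClosureModeCount.lean`
  Summit.AtomisticToContinuum.BoseEinsteinCondensation.Theorems.CorrectorClosure.InsertionModeGaussianDomination.stub_modeCount v hv hbdd hconv

/-- **S5 `stub_nearConvexity` — near-convexity of the canonical torus energy in `N` at the density box
(size M as a statement; OPEN; = the sibling crux `BECSectorPoincareTwoScale.EnergyConvexityWindow`, item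
stmt-AtomisticToContinuum-9094, specialised to `ε = 1`, index `N+1` and the box `L = sideLength ρ (N+1)` — where
`(N+1)/L³ = ρ ∈ [ρ/2, 2ρ]` — so it follows from 9094 by one instantiation + `tendsto_add_atTop_nat`
(`nearConvexity_of_energyConvexityWindow` below); filed as a stub so that the external input is visible BY
SIGNATURE and its refutation/proof traffic is shared).** For every repulsive finite-range `v` there is `ρ₅ > 0`
such that for `0 < ρ < ρ₅` and all large `N`: `2E₀(N+1,L) ≤ E₀(N+2,L) + E₀(N,L) + √(ρa)/L`, `L = sideLength ρ (N+1)`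
(expected second difference `+8πa/L³(1+o(1)) ≥ 0`; the allowance `√(ρa)/L ≫ a/L³` is what S4's slack tolerates).
Why it might fail: no proof of convexity of `N ↦ E₀(N,L)` at fixed `L` is known for continuum bosons; it is
load-bearing here. `a.toReal = 0`: allowance `0`, statement = exact convexity of the free/trivial gas (true:
`E₀ ≡ 0`). [cite: LSSY2005, Thm 2.2 (2.14) and (2.35); FournaisSolovej2020, Thm 1.1] -/
theorem stub_nearConvexity (v : ℝ → ℝ≥0∞) (hv : IsRepulsiveFiniteRange v) :
    ∃ ρ₅ : ℝ, 0 < ρ₅ ∧ ∀ ρ : ℝ, 0 < ρ → ρ < ρ₅ → ∀ᶠ N : ℕ in atTop,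
      2 * periodicGroundStateEnergy v (N + 1) (sideLength ρ (N + 1)) ≤
        periodicGroundStateEnergy v (N + 2) (sideLength ρ (N + 1)) +
          periodicGroundStateEnergy v N (sideLength ρ (N + 1)) +
          ENNReal.ofReal (Real.sqrt (ρ * (scatteringLength v).toReal) / sideLength ρ (N + 1)) := by
  sorry

/-- **S6 `stub_removalFidelity` — factor 2: the removal (hole) residue floor at `k = 0` given K1, bounded
potentials (size XL, OPEN; typed VERBATIM as in line `residue-area-law` v6.1 = hypothesis `hFid` of the landed
`correctorClosure_of_factors`, p122159, so that ONE shared removal module serves every PeriodicBEC-factor line: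
card `zero-mode-removal-susceptibility`, `F ≥ 1 − √(μ_{N+1} b̃₋(0)/n₀)` with `RemovalEnergyBudget` (landed,
p135833) + the guarded `RegularRemovalSusceptibility`; the `k = 0` member of the hole-susceptibility family `b₋(k)`
of THIS line).** Given `StaticResponseBound`, for every BOUNDED repulsive finite-range `v` there is `ρ₃ > 0` such that
for `0 < ρ < ρ₃` there is `c₂ > 0` with, for all large `N` (box `L = sideLength ρ (N+1)`, `v^per` bounded) and all
continuous positive torus FK ground states `Θ₀` (`N` bodies), `Φ₀` (`N+1` bodies): `c₂ ∫_{cell^N} G² ≤ (∫_{cell^N} Θ₀ G)²`,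
`G(X) = ∫_cell Φ₀(x,X) dx`. Bogoliubov: `1 − F = O(√(ρa³) log(L/ξ)/N)`. Known biter (declared):
SymmetryBreakingWithoutCondensate. [cite: PenroseOnsager1956, §4; LampartTriay2025, Cor. 1.6] -/
theorem stub_removalFidelity (hK1 : StaticResponseBound) (v : ℝ → ℝ≥0∞) (hv : IsRepulsiveFiniteRange v)
    (hbdd : ∃ C : ℝ≥0, ∀ r, v r ≤ C) :
    ∃ ρ₃ : ℝ, 0 < ρ₃ ∧ ∀ ρ : ℝ, 0 < ρ → ρ < ρ₃ → ∃ c₂ : ℝ, 0 < c₂ ∧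
      ∀ᶠ N : ℕ in atTop, ∀ (L : ℝ), L = sideLength ρ (N + 1) →
        (∃ C : ℝ≥0, ∀ x, periodizedPotential v L x ≤ C) →
        ∀ (Θ₀ : Config N → ℝ), IsPeriodicGroundStateFK v L Θ₀ → Continuous Θ₀ → (∀ X, 0 < Θ₀ X) →
        ∀ (Φ₀ : Config (N + 1) → ℝ), IsPeriodicGroundStateFK v L Φ₀ → Continuous Φ₀ →
          (∀ X, 0 < Φ₀ X) →
        ∀ (G : Config N → ℝ), (G = fun X => ∫ x in cell L, Φ₀ (vecCons x X)) →
          ENNReal.ofReal c₂ * ∫⁻ X in cellN N L, ENNReal.ofReal (G X) ^ 2 ≤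
            ENNReal.ofReal ((∫ X in cellN N L, Θ₀ X * G X) ^ 2) := by
  sorry

/-- **S7 `stub_unboundedCase` — the unbounded (hard / singular core) SCOPE HOLE: the crux itself for
unbounded admissible potentials, typed VERBATIM as in lines `healing-scale-kac-insertion` / `residue-area-law`
(= hypothesis `hUnb` of p122159; UNDELEGATED).** For an admissible `v` that is NOT bounded the FK frame has no
input (torus Feynman–Kac theory is stated for BOUNDED `v^per` only) and the CCR budget of S1 is void
(`Λ = 2ρ‖v‖₁ = ∞`) — consistent with Disproof §4 (`E₀ < ⊤` must be used) and §16. Expected discharges: (i) the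
hard-core FK frame + the whole chain in REMOVAL/pair-dressed form (`a(fφ_k)`, `v̂` replaced by the scattering
amplitude), or (ii) truncation `min(v, M) ↑ v` with `M`-uniform constants — neither in hand; or mooted by route
BECHardSphereReduction. Registered so that the composition is honest and the hole is attackable by name.
Diluteness (Disproof §10) respected: `∃ ρ₀ > 0`. [cite: LSSY2005, Thm 2.5] -/
theorem stub_unboundedCase (hK1 : StaticResponseBound) (v : ℝ → ℝ≥0∞) (hv : IsRepulsiveFiniteRange v)
    (hub : ¬ ∃ C : ℝ≥0, ∀ r, v r ≤ C) :
    ∃ ρ₀ : ℝ, 0 < ρ₀ ∧ ∀ ρ : ℝ, 0 < ρ → ρ < ρ₀ → ∃ c : ℝ, 0 < c ∧ ∀ᶠ N : ℕ in Filter.atTop,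
      ∃ δ : ENNReal, 0 < δ ∧ ∃ Θ : PeriodicTrialState N (sideLength ρ (N + 1)),
        periodicEnergy v Θ ≤ periodicGroundStateEnergy v N (sideLength ρ (N + 1)) + δ ∧
        ∀ Ψ : PeriodicTrialState (N + 1) (sideLength ρ (N + 1)),
          periodicEnergy v Ψ ≤ periodicGroundStateEnergy v (N + 1) (sideLength ρ (N + 1)) + δ →
          ENNReal.ofReal c ≤ ENNReal.ofReal ((sideLength ρ (N + 1) ^ 3)⁻¹) *
            (‖∫ X in cellN N (sideLength ρ (N + 1)), conj (Θ.ψ X) *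
                ∫ x in cell (sideLength ρ (N + 1)), Ψ.ψ (vecCons x X)‖₊ : ℝ≥0∞) ^ 2 := by
  sorry

/-! ## S5 is the sibling item 9094 (sorry-free bridge, for the record and for modus ponens) -/

/-- **`EnergyConvexityWindow` (item stmt-AtomisticToContinuum-9094, route BECSectorPoincareTwoScale) implies the body of
`stub_nearConvexity`**: instantiate at `ε = 1`, shift the index `N ↦ N+1` (`tendsto_add_atTop_nat`) and use that the
box `L = sideLength ρ (N+1)` has density EXACTLY `ρ` (`div_sideLength_pow_three`), inside the window `[ρ/2, 2ρ]`.
So S5 closes by modus ponens the day 9094 lands, and a refutation of S5 refutes 9094. [folklore] -/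
theorem nearConvexity_of_energyConvexityWindow
    (hECW : Summit.AtomisticToContinuum.BoseEinsteinCondensation.Theses.BECSectorPoincareTwoScale.EnergyConvexityWindow)
    (v : ℝ → ℝ≥0∞) (hv : IsRepulsiveFiniteRange v) :
    ∃ ρ₅ : ℝ, 0 < ρ₅ ∧ ∀ ρ : ℝ, 0 < ρ → ρ < ρ₅ → ∀ᶠ N : ℕ in atTop,
      2 * periodicGroundStateEnergy v (N + 1) (sideLength ρ (N + 1)) ≤
        periodicGroundStateEnergy v (N + 2) (sideLength ρ (N + 1)) +
          periodicGroundStateEnergy v N (sideLength ρ (N + 1)) +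
          ENNReal.ofReal (Real.sqrt (ρ * (scatteringLength v).toReal) / sideLength ρ (N + 1)) := by
  obtain ⟨ρ₁, hρ₁, h⟩ := hECW v hv
  refine ⟨ρ₁, hρ₁, fun ρ hρ hρ₁' => ?_⟩
  have h1 := h 1 one_pos ρ hρ hρ₁'
  have h2 := (tendsto_add_atTop_nat 1).eventually h1
  filter_upwards [h2] with N hN
  have hL : 0 < sideLength ρ (N + 1) := sideLength_succ_pos hρ N
  have hdens : ((N + 1 : ℕ) : ℝ) / sideLength ρ (N + 1) ^ 3 = ρ :=
    div_sideLength_pow_three hρ (Nat.succ_pos N)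
  have hlo : ρ / 2 ≤ ((N + 1 : ℕ) : ℝ) / sideLength ρ (N + 1) ^ 3 := by rw [hdens]; linarith
  have hhi : ((N + 1 : ℕ) : ℝ) / sideLength ρ (N + 1) ^ 3 ≤ 2 * ρ := by rw [hdens]; linarith
  have h3 := hN (sideLength ρ (N + 1)) hL hlo hhi
  have h12 : N + 1 + 1 = N + 2 := rfl
  rw [h12, Nat.add_sub_cancel, one_mul] at h3
  exact h3

/-! ## Sorry-free composition

Factor 1 in its ground-state form (`f₀(Φ₀) ≥ c₁`) from S1–S5 (`f0Floor_of_stubs`), then the landed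
reduction p122159 re-run with that form (`residueFloor_of_f0'`, `correctorClosure_of_f0`: verbatim copies of
`residueFloor_of_factors'` / `correctorClosure_of_factors` minus the window-transfer line), then the crux BY NAME. -/

/-- **Factor 1 from the line's stubs (pure logic; the quantifier bookkeeping of the card's CLOSING).** The
near-convexity supplier is a parameter (S5, or item 9094 through `nearConvexity_of_energyConvexityWindow`). Order of
choices: `M₀` from S4 (UV cut, `v` only) → `B₁, ρ₂` from S2 (K1) → `B, ρ₃` from S3 → `ρ₄, c₁` from S4; then
eventually in `N ≥ 1`, S1 per mode (with `∫v < ∞` for bounded finite-range `v`) and S2 ∘ S3 per window mode feed S4.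
[folklore] -/
theorem f0Floor_of_stubs
    (hconvAll : ∀ v : ℝ → ℝ≥0∞, IsRepulsiveFiniteRange v →
      ∃ ρ₅ : ℝ, 0 < ρ₅ ∧ ∀ ρ : ℝ, 0 < ρ → ρ < ρ₅ → ∀ᶠ N : ℕ in atTop,
        2 * periodicGroundStateEnergy v (N + 1) (sideLength ρ (N + 1)) ≤
          periodicGroundStateEnergy v (N + 2) (sideLength ρ (N + 1)) +
            periodicGroundStateEnergy v N (sideLength ρ (N + 1)) +
            ENNReal.ofReal (Real.sqrt (ρ * (scatteringLength v).toReal) / sideLength ρ (N + 1)))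
    (hK1 : StaticResponseBound) (v : ℝ → ℝ≥0∞) (hv : IsRepulsiveFiniteRange v)
    (hbdd : ∃ C : ℝ≥0, ∀ r, v r ≤ C) :
    ∃ ρ₀ : ℝ, 0 < ρ₀ ∧ ∀ ρ : ℝ, 0 < ρ → ρ < ρ₀ → ∃ c₁ : ℝ, 0 < c₁ ∧
      ∀ᶠ N : ℕ in atTop, ∀ (L : ℝ), L = sideLength ρ (N + 1) →
        (∃ C : ℝ≥0, ∀ x, periodizedPotential v L x ≤ C) →
        ∀ (Θ₀ : Config N → ℝ), IsPeriodicGroundStateFK v L Θ₀ → Continuous Θ₀ → (∀ X, 0 < Θ₀ X) →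
        ∀ (Φ₀ : Config (N + 1) → ℝ), IsPeriodicGroundStateFK v L Φ₀ → Continuous Φ₀ →
          (∀ X, 0 < Φ₀ X) →
          ENNReal.ofReal c₁ ≤ taggedZeroModeOccupation N L (fun X => (Φ₀ X : ℂ)) := by
  obtain ⟨M₀, hM₀, hCount⟩ := stub_modeCount v hv hbdd (hconvAll v hv)
  obtain ⟨B₁, hB₁, ρ₂, hρ₂, hFO⟩ := stub_firstOrderInput hK1 v hv
  obtain ⟨B, hB, ρ₃, hρ₃, hR⟩ := stub_remainderDomination v hv hbdd B₁ hB₁ M₀ hM₀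
  obtain ⟨ρ₄, hρ₄, c₁, hc₁, hC⟩ := hCount B hB
  have hint : (∫⁻ x : Space, v ‖x‖) ≠ ⊤ := lintegral_ne_top_of_bounded hv hbdd
  refine ⟨min ρ₂ (min ρ₃ ρ₄), lt_min hρ₂ (lt_min hρ₃ hρ₄), fun ρ hρ hρlt => ⟨c₁, hc₁, ?_⟩⟩
  have hρ₂' : ρ < ρ₂ := lt_of_lt_of_le hρlt (min_le_left _ _)
  have hρ₃' : ρ < ρ₃ := lt_of_lt_of_le (lt_of_lt_of_le hρlt (min_le_right _ _)) (min_le_left _ _)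
  have hρ₄' : ρ < ρ₄ := lt_of_lt_of_le (lt_of_lt_of_le hρlt (min_le_right _ _)) (min_le_right _ _)
  filter_upwards [hFO ρ hρ hρ₂', hR ρ hρ hρ₃', hC ρ hρ hρ₄', eventually_ge_atTop 1] with N hFON hRN hCN hN1
    L hL_def hb Θ₀ hΘ hΘc hΘp Φ₀ hΦ hΦc hΦp
  have hL : 0 < L := by rw [hL_def]; exact sideLength_succ_pos hρ N
  refine hCN L hL_def hb Θ₀ hΘ hΘc hΘp Φ₀ hΦ hΦc hΦp ?_ ?_
  · intro n hn b hb0 hdom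
    exact stub_holeKLS v hv hint N hN1 L hL hb Θ₀ hΘ hΘc hΘp Φ₀ hΦ hΦc hΦp n hn b hb0 hdom
  · intro n hn hwin
    exact hRN L hL_def hb Θ₀ hΘ hΘc hΘp Φ₀ hΦ hΦc hΦp n hn hwin (hFON L hL_def hb Θ₀ hΘ hΘc hΘp n hn)

/-- **The residue floor from factor 1 in `f₀`-form and factor 2** (= `residueFloor_of_factors'` of p122159 with
the window-transfer line `stub_occupationFloorFK_of_window` deleted: the `f₀`-floor is now a hypothesis on the FK
ground state itself). `A = L⁻³(∫Θ₀G)² ≥ L⁻³c₂∫G² = c₂f₀ ≥ c₁c₂`. [folklore] -/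
theorem residueFloor_of_f0'
    (hF0 : StaticResponseBound → ∀ v : ℝ → ℝ≥0∞, IsRepulsiveFiniteRange v →
      (∃ C : ℝ≥0, ∀ r, v r ≤ C) →
      ∃ ρ₀ : ℝ, 0 < ρ₀ ∧ ∀ ρ : ℝ, 0 < ρ → ρ < ρ₀ → ∃ c₁ : ℝ, 0 < c₁ ∧
        ∀ᶠ N : ℕ in atTop, ∀ (L : ℝ), L = sideLength ρ (N + 1) →
          (∃ C : ℝ≥0, ∀ x, periodizedPotential v L x ≤ C) →
          ∀ (Θ₀ : Config N → ℝ), IsPeriodicGroundStateFK v L Θ₀ → Continuous Θ₀ → (∀ X, 0 < Θ₀ X) →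
          ∀ (Φ₀ : Config (N + 1) → ℝ), IsPeriodicGroundStateFK v L Φ₀ → Continuous Φ₀ →
            (∀ X, 0 < Φ₀ X) →
            ENNReal.ofReal c₁ ≤ taggedZeroModeOccupation N L (fun X => (Φ₀ X : ℂ)))
    (hFid : StaticResponseBound → ∀ v : ℝ → ℝ≥0∞, IsRepulsiveFiniteRange v →
      (∃ C : ℝ≥0, ∀ r, v r ≤ C) →
      ∃ ρ₃ : ℝ, 0 < ρ₃ ∧ ∀ ρ : ℝ, 0 < ρ → ρ < ρ₃ → ∃ c₂ : ℝ, 0 < c₂ ∧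
        ∀ᶠ N : ℕ in atTop, ∀ (L : ℝ), L = sideLength ρ (N + 1) →
          (∃ C : ℝ≥0, ∀ x, periodizedPotential v L x ≤ C) →
          ∀ (Θ₀ : Config N → ℝ), IsPeriodicGroundStateFK v L Θ₀ → Continuous Θ₀ → (∀ X, 0 < Θ₀ X) →
          ∀ (Φ₀ : Config (N + 1) → ℝ), IsPeriodicGroundStateFK v L Φ₀ → Continuous Φ₀ →
            (∀ X, 0 < Φ₀ X) →
          ∀ (G : Config N → ℝ), (G = fun X => ∫ x in cell L, Φ₀ (vecCons x X)) →
            ENNReal.ofReal c₂ * ∫⁻ X in cellN N L, ENNReal.ofReal (G X) ^ 2 ≤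
              ENNReal.ofReal ((∫ X in cellN N L, Θ₀ X * G X) ^ 2))
    (hK1 : StaticResponseBound) (v : ℝ → ℝ≥0∞) (hv : IsRepulsiveFiniteRange v)
    (hbdd : ∃ C : ℝ≥0, ∀ r, v r ≤ C) :
    ∃ ρ₂ : ℝ, 0 < ρ₂ ∧ ∀ ρ : ℝ, 0 < ρ → ρ < ρ₂ → ∃ c : ℝ, 0 < c ∧
      ∀ᶠ N : ℕ in atTop, ∀ (L : ℝ), L = sideLength ρ (N + 1) →
        (∃ C : ℝ≥0, ∀ x, periodizedPotential v L x ≤ C) →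
        ∀ (Θ₀ : Config N → ℝ), IsPeriodicGroundStateFK v L Θ₀ → Continuous Θ₀ → (∀ X, 0 < Θ₀ X) →
        ∀ (Φ₀ : Config (N + 1) → ℝ), IsPeriodicGroundStateFK v L Φ₀ → Continuous Φ₀ →
          (∀ X, 0 < Φ₀ X) →
          ENNReal.ofReal c ≤
            ENNReal.ofReal ((L ^ 3)⁻¹ *
              (∫ X in cellN N L, Θ₀ X * ∫ x in cell L, Φ₀ (vecCons x X)) ^ 2) := by
  obtain ⟨ρ₀, hρ₀, hBEC₀⟩ := hF0 hK1 v hv hbdd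
  obtain ⟨ρ₃, hρ₃, hFid₀⟩ := hFid hK1 v hv hbdd
  refine ⟨min ρ₀ ρ₃, lt_min hρ₀ hρ₃, fun ρ hρ hρlt => ?_⟩
  have hρ₀' : ρ < ρ₀ := lt_of_lt_of_le hρlt (min_le_left _ _)
  have hρ₃' : ρ < ρ₃ := lt_of_lt_of_le hρlt (min_le_right _ _)
  obtain ⟨c₁, hc₁, hBECc⟩ := hBEC₀ ρ hρ hρ₀'
  obtain ⟨c₂, hc₂, hFidc⟩ := hFid₀ ρ hρ hρ₃'
  refine ⟨c₁ * c₂, by positivity, ?_⟩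
  filter_upwards [hBECc, hFidc] with N hBECN hFidN L hL_def hb Θ₀ hΘ hΘc hΘp Φ₀ hΦ hΦc hΦp
  have hL : 0 < L := by rw [hL_def]; exact sideLength_succ_pos hρ N
  set G : Config N → ℝ := fun X => ∫ x in cell L, Φ₀ (vecCons x X) with hG_def
  -- factor 1: `c₁ ≤ f₀(Φ₀)` (hypothesis, FK form)
  have hf₀ : ENNReal.ofReal c₁ ≤ taggedZeroModeOccupation N L (fun X => (Φ₀ X : ℂ)) :=
    hBECN L hL_def hb Θ₀ hΘ hΘc hΘp Φ₀ hΦ hΦc hΦp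
  rw [taggedZeroModeOccupation_ofReal_eq L hΦp] at hf₀
  -- factor 2: `c₂ ∫ G² ≤ (∫ Θ₀ G)²`
  have hF : ENNReal.ofReal c₂ * ∫⁻ X in cellN N L, ENNReal.ofReal (G X) ^ 2 ≤
      ENNReal.ofReal ((∫ X in cellN N L, Θ₀ X * G X) ^ 2) :=
    hFidN L hL_def hb Θ₀ hΘ hΘc hΘp Φ₀ hΦ hΦc hΦp G rfl
  -- combine: `c₁ c₂ ≤ c₂ · (L³)⁻¹ ∫G² ≤ (L³)⁻¹ (∫Θ₀G)²`
  calc ENNReal.ofReal (c₁ * c₂)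
      = ENNReal.ofReal c₂ * ENNReal.ofReal c₁ := by
        rw [ENNReal.ofReal_mul hc₁.le, mul_comm]
    _ ≤ ENNReal.ofReal c₂ * ((ENNReal.ofReal L ^ 3)⁻¹ *
          ∫⁻ X in cellN N L, ENNReal.ofReal (G X) ^ 2) := by gcongr
    _ = (ENNReal.ofReal L ^ 3)⁻¹ *
          (ENNReal.ofReal c₂ * ∫⁻ X in cellN N L, ENNReal.ofReal (G X) ^ 2) := by ring
    _ ≤ (ENNReal.ofReal L ^ 3)⁻¹ * ENNReal.ofReal ((∫ X in cellN N L, Θ₀ X * G X) ^ 2) := by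
        gcongr
    _ = ENNReal.ofReal ((L ^ 3)⁻¹ * (∫ X in cellN N L, Θ₀ X * G X) ^ 2) := by
        rw [ENNReal.ofReal_mul (by positivity), ENNReal.ofReal_inv_of_pos (by positivity),
          ENNReal.ofReal_pow hL.le]

/-- **The crux (unfolded: `StaticResponseBound → InsertionResidue`) from factor 1 in `f₀`-form, factor 2 and the scope
hole** (= `correctorClosure_of_factors` of p122159 with `residueFloor_of_factors'` replaced by `residueFloor_of_f0'`). Unbounded `v`: `hUnb`. Bounded `v`:
thresholds `min ρᵢ`; eventually in `N` the torus FK ground states exist, are continuous and positive with `v^per`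
bounded (`stub_groundStateExists`, p92339); the floor `c ≤ A`; rigidity at `ε = c/2` (`stub_nearMinimiserRigidity`,
p85784) moves it to `c/2 ≤ Res(Θ, Ψ)` for some `δ`-near-minimiser `Θ` and every `δ`-near-minimiser `Ψ`, `δ` AFTER
`N` (Disproof §3/§7). [folklore] -/
theorem correctorClosure_of_f0
    (hF0 : StaticResponseBound → ∀ v : ℝ → ℝ≥0∞, IsRepulsiveFiniteRange v →
      (∃ C : ℝ≥0, ∀ r, v r ≤ C) →
      ∃ ρ₀ : ℝ, 0 < ρ₀ ∧ ∀ ρ : ℝ, 0 < ρ → ρ < ρ₀ → ∃ c₁ : ℝ, 0 < c₁ ∧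
        ∀ᶠ N : ℕ in atTop, ∀ (L : ℝ), L = sideLength ρ (N + 1) →
          (∃ C : ℝ≥0, ∀ x, periodizedPotential v L x ≤ C) →
          ∀ (Θ₀ : Config N → ℝ), IsPeriodicGroundStateFK v L Θ₀ → Continuous Θ₀ → (∀ X, 0 < Θ₀ X) →
          ∀ (Φ₀ : Config (N + 1) → ℝ), IsPeriodicGroundStateFK v L Φ₀ → Continuous Φ₀ →
            (∀ X, 0 < Φ₀ X) →
            ENNReal.ofReal c₁ ≤ taggedZeroModeOccupation N L (fun X => (Φ₀ X : ℂ)))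
    (hFid : StaticResponseBound → ∀ v : ℝ → ℝ≥0∞, IsRepulsiveFiniteRange v →
      (∃ C : ℝ≥0, ∀ r, v r ≤ C) →
      ∃ ρ₃ : ℝ, 0 < ρ₃ ∧ ∀ ρ : ℝ, 0 < ρ → ρ < ρ₃ → ∃ c₂ : ℝ, 0 < c₂ ∧
        ∀ᶠ N : ℕ in atTop, ∀ (L : ℝ), L = sideLength ρ (N + 1) →
          (∃ C : ℝ≥0, ∀ x, periodizedPotential v L x ≤ C) →
          ∀ (Θ₀ : Config N → ℝ), IsPeriodicGroundStateFK v L Θ₀ → Continuous Θ₀ → (∀ X, 0 < Θ₀ X) →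
          ∀ (Φ₀ : Config (N + 1) → ℝ), IsPeriodicGroundStateFK v L Φ₀ → Continuous Φ₀ →
            (∀ X, 0 < Φ₀ X) →
          ∀ (G : Config N → ℝ), (G = fun X => ∫ x in cell L, Φ₀ (vecCons x X)) →
            ENNReal.ofReal c₂ * ∫⁻ X in cellN N L, ENNReal.ofReal (G X) ^ 2 ≤
              ENNReal.ofReal ((∫ X in cellN N L, Θ₀ X * G X) ^ 2))
    (hUnb : StaticResponseBound → ∀ v : ℝ → ℝ≥0∞, IsRepulsiveFiniteRange v →
      (¬ ∃ C : ℝ≥0, ∀ r, v r ≤ C) →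
      ∃ ρ₀ : ℝ, 0 < ρ₀ ∧ ∀ ρ : ℝ, 0 < ρ → ρ < ρ₀ → ∃ c : ℝ, 0 < c ∧ ∀ᶠ N : ℕ in Filter.atTop,
        ∃ δ : ENNReal, 0 < δ ∧ ∃ Θ : PeriodicTrialState N (sideLength ρ (N + 1)),
          periodicEnergy v Θ ≤ periodicGroundStateEnergy v N (sideLength ρ (N + 1)) + δ ∧
          ∀ Ψ : PeriodicTrialState (N + 1) (sideLength ρ (N + 1)),
            periodicEnergy v Ψ ≤ periodicGroundStateEnergy v (N + 1) (sideLength ρ (N + 1)) + δ →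
            ENNReal.ofReal c ≤ ENNReal.ofReal ((sideLength ρ (N + 1) ^ 3)⁻¹) *
              (‖∫ X in cellN N (sideLength ρ (N + 1)), conj (Θ.ψ X) *
                  ∫ x in cell (sideLength ρ (N + 1)), Ψ.ψ (vecCons x X)‖₊ : ℝ≥0∞) ^ 2) :
    StaticResponseBound → InsertionResidue := by
  -- conclusion = the UNFOLDED crux (`CorrectorClosure := StaticResponseBound → InsertionResidue`), so that the
  -- hypothesis-free `CorrectorClosure_of` below is the file's first (and registered) theorem concluding the crux BY NAME
  intro hK1 v hv
  by_cases hbdd : ∃ C : ℝ≥0, ∀ r, v r ≤ C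
  swap
  · exact hUnb hK1 v hv hbdd
  obtain ⟨ρA, hρA, hGS⟩ := stub_groundStateExists v hv hbdd
  obtain ⟨ρ₂, hρ₂, hFl⟩ := residueFloor_of_f0' hF0 hFid hK1 v hv hbdd
  refine ⟨min ρA ρ₂, lt_min hρA hρ₂, fun ρ hρ hρlt => ?_⟩
  have hρA' : ρ < ρA := lt_of_lt_of_le hρlt (min_le_left _ _)
  have hρ₂' : ρ < ρ₂ := lt_of_lt_of_le hρlt (min_le_right _ _)
  obtain ⟨c, hc, hFlc⟩ := hFl ρ hρ hρ₂'
  refine ⟨c / 2, by positivity, ?_⟩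
  filter_upwards [hGS ρ hρ hρA', hFlc] with N hGSN hFlN
  obtain ⟨hb, ⟨hΘ, hΘc, hΘp⟩, ⟨hΦ, hΦc, hΦp⟩⟩ := hGSN
  set L : ℝ := sideLength ρ (N + 1) with hL_def
  have hL : 0 < L := sideLength_succ_pos hρ N
  set Θ₀ : Config N → ℝ := periodicFKGroundState v N L with hΘ₀_def
  set Φ₀ : Config (N + 1) → ℝ := periodicFKGroundState v (N + 1) L with hΦ₀_def
  set A : ℝ≥0∞ := ENNReal.ofReal ((L ^ 3)⁻¹ *
      (∫ X in cellN N L, Θ₀ X * ∫ x in cell L, Φ₀ (vecCons x X)) ^ 2) with hA_def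
  -- the floor: `c ≤ A`
  have hfloor : ENNReal.ofReal c ≤ A := hFlN L rfl hb Θ₀ hΘ hΘc hΘp Φ₀ hΦ hΦc hΦp
  -- rigidity at `ε = c/2`: transfer to the near-minimiser frame
  obtain ⟨δ, hδ, Θ, hΘE, hΨ⟩ := stub_nearMinimiserRigidity v hv N L hL hb Θ₀ hΘ hΘc hΘp Φ₀ hΦ hΦc
    hΦp (c / 2) (by positivity)
  refine ⟨δ, hδ, Θ, hΘE, fun Ψ hΨE => ?_⟩
  set R : ℝ≥0∞ := ENNReal.ofReal ((L ^ 3)⁻¹) *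
      (‖∫ X in cellN N L, conj (Θ.ψ X) * ∫ x in cell L, Ψ.ψ (vecCons x X)‖₊ : ℝ≥0∞) ^ 2 with hR_def
  have hAR : A ≤ R + ENNReal.ofReal (c / 2) := hΨ Ψ hΨE
  have hsplit : ENNReal.ofReal c = ENNReal.ofReal (c / 2) + ENNReal.ofReal (c / 2) := by
    rw [← ENNReal.ofReal_add (by positivity) (by positivity)]
    congr 1; ring
  have h2 : ENNReal.ofReal (c / 2) + ENNReal.ofReal (c / 2) ≤ R + ENNReal.ofReal (c / 2) := by
    rw [← hsplit]; exact hfloor.trans hAR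
  exact (ENNReal.add_le_add_iff_right ENNReal.ofReal_ne_top).1 h2

/-! ## Composition (sorry-free): the registered stubs give the crux BY NAME -/

/-- **`CorrectorClosure` from the seven registered stubs** (kernel-checked glue, no `sorry` of its own):
factor 1 = `f0Floor_of_stubs` (S1–S5), factor 2 = S6, scope hole = S7, composed by `correctorClosure_of_f0`
(the landed reduction p122159 in `f₀`-form). [folklore] -/
theorem CorrectorClosure_of : CorrectorClosure :=
  correctorClosure_of_f0 (f0Floor_of_stubs stub_nearConvexity) stub_removalFidelity stub_unboundedCase

/-- **The same composition with S5 replaced by the sibling ITEM 9094 by name** (`EnergyConvexityWindow`, route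
BECSectorPoincareTwoScale): the line modulo S1–S4, S6, S7 and a registered obligation of the sub-problem — the
honest dependency graph of the card ("9094-weak is load-bearing"), kernel-checked. [folklore] -/
theorem CorrectorClosure_of_energyConvexityWindow
    (hECW : Summit.AtomisticToContinuum.BoseEinsteinCondensation.Theses.BECSectorPoincareTwoScale.EnergyConvexityWindow) :
    CorrectorClosure :=
  correctorClosure_of_f0 (f0Floor_of_stubs (nearConvexity_of_energyConvexityWindow hECW)) stub_removalFidelity
    stub_unboundedCase


/-- **The same composition with the HEART DISCHARGED CONDITIONALLY by the sibling crux item 12620** (`BECTwoSectorGD.GaussianDomination`,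
through the landed `holeModeDomination_of_gaussianDomination`, p146353) **and S5 by item 9094**: `CorrectorClosure` modulo
12620 ∧ 9094 ∧ S6 ∧ S7, kernel-checked through the landed K1-free reduction `correctorClosure_of_holeModeDomination` (p144723).
This records that the line's heart C⁺ is WEAKER than 12620 (two powers of `p` on the window). [folklore] -/
theorem CorrectorClosure_of_gaussianDomination_energyConvexityWindow
    (hGD : Summit.AtomisticToContinuum.BoseEinsteinCondensation.Theses.BECTwoSectorGD.GaussianDomination)
    (hECW : Summit.AtomisticToContinuum.BoseEinsteinCondensation.Theses.BECSectorPoincareTwoScale.EnergyConvexityWindow) :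
    CorrectorClosure :=
  Summit.AtomisticToContinuum.BoseEinsteinCondensation.Theorems.CorrectorClosure.InsertionModeGaussianDomination.correctorClosure_of_holeModeDomination
    (Summit.AtomisticToContinuum.BoseEinsteinCondensation.Theorems.CorrectorClosure.InsertionModeGaussianDomination.holeModeDomination_of_gaussianDomination hGD)
    (nearConvexity_of_energyConvexityWindow hECW) stub_removalFidelity stub_unboundedCase

/-- **What the line gives for the conjunct WITHOUT S6/S7** (landed, p146276): remainder domination (S3) ∧ near-convexity
(S5-body) ∧ K1 ⊢ the PeriodicBEC body (item 8997's signature: torus BEC of near-minimisers) for every BOUNDED admissible `v` —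
re-exported here so that the skeleton shows the dependency: the insertion residue (hence S6) is needed only for `Z_N ≥ c`
itself, and S7 only for unbounded `v`. [folklore] -/
theorem periodicBEC_bounded_of_stubs (hK1 : StaticResponseBound) (v : ℝ → ℝ≥0∞) (hv : IsRepulsiveFiniteRange v)
    (hbdd : ∃ C : ℝ≥0, ∀ r, v r ≤ C) :
    ∃ ρ₀ : ℝ, 0 < ρ₀ ∧ ∀ ρ : ℝ, 0 < ρ → ρ < ρ₀ → ∃ c : ℝ, 0 < c ∧ ∀ᶠ N : ℕ in atTop,
      ∃ δ : ℝ≥0∞, 0 < δ ∧ ∀ Ψ : PeriodicTrialState N (sideLength ρ N),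
        periodicEnergy v Ψ ≤ periodicGroundStateEnergy v N (sideLength ρ N) + δ →
        ENNReal.ofReal (c * N) ≤ condensateOccupation N (sideLength ρ N) Ψ.ψ :=
  Summit.AtomisticToContinuum.BoseEinsteinCondensation.Theorems.CorrectorClosure.InsertionModeGaussianDomination.periodicBEC_bounded_of_remainderDomination
    stub_remainderDomination stub_nearConvexity hK1 v hv hbdd

end Summit.AtomisticToContinuum.BoseEinsteinCondensation.Cruxes.CorrectorClosure.InsertionModeGaussianDomination

end
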